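import Summits.CriticalPhenomena.PercolationContinuityZ3.Theorems.PercNearOneGluingNoHeavyQuantIndepBlobBigCarriers
import Summits.CriticalPhenomena.PercolationContinuityZ3.Theorems.PercNearOneGluingNoHeavyQuantIndepBlobTruncatedMean
import Summits.CriticalPhenomena.PercolationContinuityZ3.Theorems.PercNearOneGluingNoHeavyQuantIndepBlobCloudComponents
import HarnessLib

/-!
# QUANT lane R8, Conjecture DIB\* — the CARRIER CERTIFICATE (light routes of the big lights + heavy routes of every other outcome),
# part (XI) of the cloud series; discharged in part (XII) `…HalfShortfall` for every cloud whose lights all exceed half the shortfall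

builds on p205010 (kernel theorem, internal audit signed; external expert review pending)

Support file (`--supports stmt-CriticalPhenomena-4575`), QUANT lane census seat prim-quant-census-1 (gen 16), rung R8 of
`run/shared/lean/prim/quant/LADDER.md`; memo `run/shared/lean/prim/quant/prim-quant-census-1/TRUNCATED-MEAN-G16.md` §4.  Theorems only, no
definitions, no sorries, standard axioms.

SETTING (cloud series).  Blobs `k`, sizes `a k`, gates `p k ∈ [0,1]`, floor `x`; the cloud `L` (gates `< x`), every other blob heavy
(`x ≤ p`), `C_H = Σ_{k ∉ L} a·p`, shortfall `Cp = 2j − C_H > 0`; restricted weights `w_L(S)`, heavy restricted tail `TL`.  REGIME: every light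
bigger than half the shortfall (`2a_k > Cp`), so every non-empty outcome of the cloud is certified by its own mass and only the empty outcome
must be carried (SMALL-CLOUD-G15 §9–§10: 66 % of sampled corner clouds at the hardest budget).  CARRIERS `B` = the BIG lights
(`x·a > Cp`, `a ≤ j`): an outcome with a carrier open is carried by the LIGHT component of its largest open carrier `b*`
(or by the bigger light component `(0, h, γ)`, `h = min(a(S ∩ B), j) ≥ b*`, `γ > γ*(h) = x² + (1 − x)Cp/h`, worth `ℓ(h) = h/(x²h + (1 − x)Cp) ≥ ℓ(b*)` per unit), every other non-empty outcome by the
HEAVY component of `…CloudClamp` (worth `max(0, min(a(S)/Cp, 1/x))`).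

* `Quant.IndepBlob.tail_ge_of_carrierCert` — **the CARRIER CERTIFICATE** (generalises `tail_ge_of_clampCert`, p258923): if
  `x·Cp·w_L(∅) < Σ_S w_L(S)·Pay(S)`, `Pay(S) = x·Cp·(ℓ(min(a(S ∩ B), j)) − 1)` when `S` meets `B`, else `max(0, min(x(a(S) − Cp), (1−x)Cp))`,
  then `x ≤ P(N ≥ j+1)`.  (Every carried outcome is certified by `cloud_component_row`, p256280.)
Part (XII) `…HalfShortfall` discharges the certificate from the DIB\* credit alone (truncated-mean theorem on the medium lights, `bigCloud_value`
on the big ones) and states Conjecture DIB\* for every cloud whose lights all exceed half the shortfall.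

[this work; this lane's census]; the gluing rows served: [cite: KozmaNitzan2024, Conjecture 3 (p. 15)]; product weights
[cite: Grimmett1999, §1.3 p. 10].
-/

namespace Summit.CriticalPhenomena.PercolationContinuityZ3.Theorems

namespace Quant

namespace IndepBlob

open Finset

variable {κ : Type*} [Fintype κ] [DecidableEq κ]

/-! ### 21. The carrier certificate -/

set_option maxHeartbeats 400000 in
/-- **THE CARRIER CERTIFICATE.**  Gates in `[0,1]`, floor `0 < x < 1`, a cloud `L` off which every blob is heavy, every light `k ∈ L` with
`2j < C_H + 2·a_k`; carriers `B` with `a ≤ j` and `Cp < x·a` (`Cp = 2j − C_H`); and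
`x·Cp·Π_L(1 − p) < Σ_{S ⊆ L} w_L(S)·Pay(S)` with `Pay(S) = x·Cp·(h/(x²h + (1−x)Cp) − 1)`, `h = min(a(S ∩ B), j)`, if `S ∩ B ≠ ∅`, and
`Pay(S) = max(0, min(x(a(S) − Cp), (1 − x)Cp))` otherwise ⟹ `x ≤ P(N ≥ j+1)`. [this work] -/
theorem tail_ge_of_carrierCert (p : κ → ℝ) (a : κ → ℕ) (x : ℝ) (hx0 : 0 < x) (hx1 : x < 1)
    (hp0 : ∀ k, 0 ≤ p k) (hp1 : ∀ k, p k ≤ 1) (L : Finset κ) (hheavy : ∀ k, k ∉ L → x ≤ p k) (j : ℕ)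
    (hmid : ∀ k ∈ L, (2 * j : ℝ) < (∑ i ∈ Finset.univ \ L, (a i : ℝ) * p i) + 2 * (a k : ℝ))
    (B : Finset κ) (hBj : ∀ k ∈ B, a k ≤ j)
    (hBbig : ∀ k ∈ B, (2 * j - ∑ i ∈ Finset.univ \ L, (a i : ℝ) * p i) < x * (a k : ℝ))
    (hcert : x * (2 * j - ∑ i ∈ Finset.univ \ L, (a i : ℝ) * p i) * ∏ k ∈ L, (1 - p k) <
      ∑ S ∈ L.powerset, (∏ k ∈ L, if k ∈ S then p k else 1 - p k) *
        (if S ∩ B = ∅ then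
          max 0 (min (x * ((∑ k ∈ S, a k : ℕ) - (2 * j - ∑ i ∈ Finset.univ \ L, (a i : ℝ) * p i)))
            ((1 - x) * (2 * j - ∑ i ∈ Finset.univ \ L, (a i : ℝ) * p i)))
         else
          x * (2 * j - ∑ i ∈ Finset.univ \ L, (a i : ℝ) * p i) *
            (((min (∑ k ∈ S ∩ B, a k) j : ℕ) : ℝ) / (x ^ 2 * ((min (∑ k ∈ S ∩ B, a k) j : ℕ) : ℝ) +
              (1 - x) * (2 * j - ∑ i ∈ Finset.univ \ L, (a i : ℝ) * p i)) - 1))) :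
    x ≤ ∑ s : Finset κ, (∏ k, if k ∈ s then p k else 1 - p k) * (if j + 1 ≤ ∑ k ∈ s, a k then (1 : ℝ) else 0) := by
  have h1x : 0 < 1 - x := by linarith
  set U : Finset κ := Finset.univ \ L with hU
  set CH : ℝ := ∑ i ∈ U, (a i : ℝ) * p i with hCH
  set Cp : ℝ := 2 * j - CH with hCp
  set TL : ℕ → ℝ := fun t => ∑ T ∈ U.powerset, (∏ k ∈ U, if k ∈ T then p k else 1 - p k) *
      (if t ≤ ∑ k ∈ T, a k then (1 : ℝ) else 0) with hTL
  set wL : Finset κ → ℝ := fun S => ∏ k ∈ L, if k ∈ S then p k else 1 - p k with hwL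
  set φ : Finset κ → ℝ := fun S =>
    if S ∩ B = ∅ then max 0 (min (x * ((∑ k ∈ S, a k : ℕ) - Cp)) ((1 - x) * Cp))
    else x * Cp * (((min (∑ k ∈ S ∩ B, a k) j : ℕ) : ℝ) / (x ^ 2 * ((min (∑ k ∈ S ∩ B, a k) j : ℕ) : ℝ) + (1 - x) * Cp) - 1) with hφ
  have hwL0 : ∀ S, 0 ≤ wL S := fun S => weightU_nonneg p L (fun k _ => hp0 k) (fun k _ => hp1 k) S
  have hTLnn : ∀ t, 0 ≤ TL t := fun t => tailU_nonneg p a U (fun k _ => hp0 k) (fun k _ => hp1 k) t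
  have hTL0 : TL 0 = 1 := tailU_zero p a U
  have hTLanti : ∀ {t t' : ℕ}, t ≤ t' → TL t' ≤ TL t := fun htt =>
    tailU_antitone p a U (fun k _ => hp0 k) (fun k _ => hp1 k) htt
  have hm0 : wL ∅ = ∏ k ∈ L, (1 - p k) := Finset.prod_congr rfl fun k _ => by rw [if_neg (Finset.notMem_empty k)]
  have hm0nn : 0 ≤ wL ∅ := hwL0 ∅
  change x * Cp * ∏ k ∈ L, (1 - p k) < ∑ S ∈ L.powerset, wL S * φ S at hcert
  rw [← hm0] at hcert
  -- cloud conditioning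
  rw [tail_cloud_split p a L (j + 1)]
  change x ≤ ∑ S ∈ L.powerset, wL S * TL (j + 1 - ∑ k ∈ S, a k)
  by_cases hTLx : x ≤ TL (j + 1)
  · calc x = ∑ S ∈ L.powerset, wL S * x := by rw [← Finset.sum_mul, sum_powerset_weight p L, one_mul]
      _ ≤ ∑ S ∈ L.powerset, wL S * TL (j + 1 - ∑ k ∈ S, a k) :=
          Finset.sum_le_sum fun S _ => mul_le_mul_of_nonneg_left (hTLx.trans (hTLanti (Nat.sub_le _ _))) (hwL0 S)
  push Not at hTLx
  -- the empty outcome pays nothing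
  have hφ_clamp_nonpos : ∀ S, Cp ≤ 0 → max 0 (min (x * ((∑ k ∈ S, a k : ℕ) - Cp)) ((1 - x) * Cp)) = (0 : ℝ) := by
    intro S hC
    have : min (x * ((∑ k ∈ S, a k : ℕ) - Cp)) ((1 - x) * Cp) ≤ 0 :=
      (min_le_right _ _).trans (mul_nonpos_of_nonneg_of_nonpos h1x.le hC)
    exact le_antisymm (max_le le_rfl this) (le_max_left _ _)
  have hφ_empty' : max 0 (min (x * ((∑ k ∈ (∅ : Finset κ), a k : ℕ) - Cp)) ((1 - x) * Cp)) = (0 : ℝ) := by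
    rcases le_or_gt Cp 0 with hC | hC
    · exact hφ_clamp_nonpos ∅ hC
    · have : min (x * ((∑ k ∈ (∅ : Finset κ), a k : ℕ) - Cp)) ((1 - x) * Cp) ≤ 0 := by
        rw [Finset.sum_empty, Nat.cast_zero, zero_sub]
        exact (min_le_left _ _).trans (mul_nonpos_of_nonneg_of_nonpos hx0.le (by linarith))
      exact le_antisymm (max_le le_rfl this) (le_max_left _ _)
  have hφ_empty : φ ∅ = 0 := by
    simp only [hφ, Finset.empty_inter, if_true]
    exact hφ_empty'
  rcases L.eq_empty_or_nonempty with hL0 | ⟨ℓ₀, hℓ₀⟩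
  · exfalso
    -- with an empty cloud the certificate forces `Cp < 0`, and then the heavy row reaches `x`
    have hU0 : U = Finset.univ := by rw [hU, hL0, Finset.sdiff_empty]
    have hCpneg : Cp < 0 := by
      by_contra h
      push Not at h
      rw [hL0, Finset.powerset_empty, Finset.sum_singleton, hφ_empty] at hcert
      have h1 : wL ∅ = 1 := by rw [hm0, hL0, Finset.prod_empty]
      rw [h1] at hcert
      nlinarith
    have hbudget : (2 * j : ℝ) < 2 * ((0 : ℕ) : ℝ) + ∑ k, (a k : ℝ) * p k := by
      rw [Nat.cast_zero, mul_zero, zero_add, ← hU0]; rw [hCp] at hCpneg; linarith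
    have hfloor : ∀ k, a k ≠ 0 → x ≤ p k := fun k _ => hheavy k (by rw [hL0]; exact Finset.notMem_empty k)
    have key := RootDec.term_ge_of_budget 0 a p j x hx1.le (fun k => ⟨hp0 k, hp1 k⟩) hfloor hbudget
    simp only [zero_add] at key
    have e : TL (j + 1) = ∑ W : Finset κ, (∏ k, if k ∈ W then p k else 1 - p k) * (if j + 1 ≤ ∑ k ∈ W, a k then (1 : ℝ) else 0) := by
      simp only [hTL, hU0]
      exact tailU_univ p a (j + 1)
    rw [← e] at key
    linarith
  have hCp0 : 0 < Cp := by
    by_contra h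
    push Not at h
    rcases h.lt_or_eq with hlt | heq
    · -- negative shortfall: the heavies alone reach `x`
      have key := cloud_component_row p a x hx0 hx1 hp0 hp1 L ℓ₀ hℓ₀ hheavy j 0 0 0 le_rfl zero_le_one le_rfl (Nat.zero_le _)
        (by simp only [Nat.sub_self, Nat.cast_zero, zero_mul, mul_zero, add_zero]; rw [hCp] at hlt; linarith)
      rw [Nat.sub_zero, zero_mul, sub_zero, one_mul, zero_add] at key
      linarith
    · have hz : ∑ S ∈ L.powerset, wL S * φ S = 0 :=
        Finset.sum_eq_zero fun S _ => by
          simp only [hφ]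
          split_ifs
          · rw [hφ_clamp_nonpos S heq.le, mul_zero]
          · rw [heq]; ring
      rw [hz, heq] at hcert
      linarith [hm0nn]
  -- every non-empty light outcome is certified by its sure mass
  have hsure : ∀ S ∈ L.powerset, S ≠ ∅ → x ≤ TL (j + 1 - ∑ k ∈ S, a k) := by
    intro S hS hne
    have hSL : S ⊆ L := Finset.mem_powerset.1 hS
    obtain ⟨k, hk⟩ := Finset.nonempty_iff_ne_empty.2 hne
    have hak : a k ≤ ∑ i ∈ S, a i := Finset.single_le_sum (fun i _ => Nat.zero_le _) hk
    by_cases hbig : j + 1 ≤ ∑ i ∈ S, a i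
    · have e : j + 1 - ∑ i ∈ S, a i = 0 := by omega
      rw [e, hTL0]; exact hx1.le
    · have hle : ∑ i ∈ S, a i ≤ j := by omega
      have hcr : (2 * j : ℝ) < CH + 2 * ((∑ i ∈ S, a i : ℕ) : ℝ) +
          ((∑ i ∈ S, a i - ∑ i ∈ S, a i : ℕ) : ℝ) * (if x ≤ (0 : ℝ) then (0 : ℝ) else (0 - x ^ 2) / (1 - x)) := by
        rw [Nat.sub_self, Nat.cast_zero, zero_mul, add_zero]
        have h1 := hmid k (hSL hk)
        have h2 : ((a k : ℕ) : ℝ) ≤ ((∑ i ∈ S, a i : ℕ) : ℝ) := Nat.cast_le.2 hak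
        linarith
      have key := cloud_component_row p a x hx0 hx1 hp0 hp1 L ℓ₀ hℓ₀ hheavy j (∑ i ∈ S, a i) (∑ i ∈ S, a i) 0 le_rfl
        zero_le_one le_rfl hle hcr
      rw [zero_mul, zero_add, sub_zero, one_mul] at key
      exact key
  -- signs of the payments
  have hxCp : 0 < x * Cp := mul_pos hx0 hCp0
  have hφ0 : ∀ S, 0 ≤ φ S := by
    intro S
    simp only [hφ]
    split_ifs with hSB
    · exact le_max_left _ _
    · obtain ⟨k₀, hk₀⟩ := Finset.nonempty_iff_ne_empty.2 hSB
      have hk₀B : k₀ ∈ B := (Finset.mem_inter.1 hk₀).2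
      have hh : (a k₀ : ℝ) ≤ ((min (∑ k ∈ S ∩ B, a k) j : ℕ) : ℝ) :=
        Nat.cast_le.2 (le_min (Finset.single_le_sum (fun i _ => Nat.zero_le _) hk₀) (hBj k₀ hk₀B))
      have hℓ := one_le_bigLight_ell x Cp ((min (∑ k ∈ S ∩ B, a k) j : ℕ) : ℝ) hx0 hx1 hCp0
        ((hBbig k₀ hk₀B).le.trans (mul_le_mul_of_nonneg_left hh hx0.le))
      exact mul_nonneg hxCp.le (by linarith)
  -- the certificate's slack, and the fraction `θ < 1` of it that is spent
  set RHS : ℝ := ∑ S ∈ L.powerset, wL S * φ S with hRHS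
  set LHS : ℝ := x * Cp * wL ∅ with hLHS
  have hLHS0 : 0 ≤ LHS := mul_nonneg (mul_nonneg hx0.le hCp0.le) hm0nn
  have hRHSpos : 0 < RHS := lt_of_le_of_lt hLHS0 hcert
  set θ : ℝ := (LHS + (RHS - LHS) / 2) / RHS with hθ
  have hθ1 : θ < 1 := by rw [hθ, div_lt_one hRHSpos]; linarith
  have hθ0 : 0 ≤ θ := div_nonneg (by linarith) hRHSpos.le
  have hθRHS : θ * RHS = LHS + (RHS - LHS) / 2 := by rw [hθ]; field_simp
  -- the rate of outcome `S`: `κ_S = φ S / (x Cp)`, and the payment inequality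
  set κr : Finset κ → ℝ := fun S => φ S / (x * Cp) with hκr
  have hκ0 : ∀ S, 0 ≤ κr S := fun S => div_nonneg (hφ0 S) hxCp.le
  have hpay : ∀ S ∈ L.powerset, wL S * (θ * κr S * (x - TL (j + 1))) - (if S = ∅ then wL ∅ * (x - TL (j + 1)) else 0) ≤
      wL S * (TL (j + 1 - ∑ k ∈ S, a k) - x) := by
    intro S hS
    by_cases hS0 : S = ∅
    · subst hS0
      have hκS : κr ∅ = 0 := by show φ ∅ / (x * Cp) = 0; rw [hφ_empty, zero_div]
      rw [hκS, if_pos rfl, Finset.sum_empty, Nat.sub_zero]; ring_nf; rfl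
    rw [if_neg hS0, sub_zero]
    refine mul_le_mul_of_nonneg_left ?_ (hwL0 S)
    have hSL : S ⊆ L := Finset.mem_powerset.1 hS
    by_cases hκz : κr S = 0
    · rw [hκz, mul_zero, zero_mul]
      linarith [hsure S hS hS0]
    have hκpos : 0 < κr S := lt_of_le_of_ne (hκ0 S) (Ne.symm hκz)
    have hθκ0 : 0 ≤ θ * κr S := mul_nonneg hθ0 (hκ0 S)
    set γ : ℝ := 1 / (1 + θ * κr S) with hγ
    have hden : 0 < 1 + θ * κr S := by linarith
    have hγpos : 0 < γ := div_pos one_pos hden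
    have hγ1 : γ ≤ 1 := by rw [hγ, div_le_one hden]; linarith
    have hinv : (1 - γ) / γ = θ * κr S := by rw [hγ]; field_simp; ring
    have hθκlt : θ * κr S < κr S := by
      have : θ * κr S < 1 * κr S := mul_lt_mul_of_pos_right hθ1 hκpos
      linarith
    -- the component that carries the outcome: `(0, h, γ)` with `h = a(S)` (clamp) or `h = b*` (carrier)
    by_cases hSB : S ∩ B = ∅
    · -- CLAMP branch (verbatim the argument of `tail_ge_of_clampCert`)
      have hφS : φ S = max 0 (min (x * ((∑ k ∈ S, a k : ℕ) - Cp)) ((1 - x) * Cp)) := by simp only [hφ, if_pos hSB]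
      have hκle : κr S ≤ (1 - x) / x := by
        show φ S / (x * Cp) ≤ (1 - x) / x
        rw [div_le_div_iff₀ hxCp hx0, hφS]
        have : max 0 (min (x * ((∑ k ∈ S, a k : ℕ) - Cp)) ((1 - x) * Cp)) ≤ (1 - x) * Cp :=
          max_le (mul_nonneg h1x.le hCp0.le) (min_le_right _ _)
        nlinarith
      have hθκ1 : θ * κr S ≤ (1 - x) / x := (mul_le_of_le_one_left (hκ0 S) hθ1.le).trans hκle
      have haC : Cp < ((∑ k ∈ S, a k : ℕ) : ℝ) := by
        by_contra h
        push Not at h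
        have hφz : φ S = 0 := by
          rw [hφS]
          have : min (x * ((∑ k ∈ S, a k : ℕ) - Cp)) ((1 - x) * Cp) ≤ 0 :=
            (min_le_left _ _).trans (mul_nonpos_of_nonneg_of_nonpos hx0.le (by linarith))
          exact le_antisymm (max_le le_rfl this) (le_max_left _ _)
        exact hκz (by show φ S / (x * Cp) = 0; rw [hφz, zero_div])
      have hγx : x ≤ γ := by
        rw [hγ, le_div_iff₀ hden]
        have h3 : x * ((1 - x) / x) = 1 - x := by field_simp
        have h4 : x * (θ * κr S) ≤ x * ((1 - x) / x) := mul_le_mul_of_nonneg_left hθκ1 hx0.le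
        rw [h3] at h4
        linarith
      have hcredit : Cp < ((∑ k ∈ S, a k : ℕ) : ℝ) * γ := by
        rw [hγ, mul_one_div, lt_div_iff₀ hden]
        have h1 : κr S ≤ (((∑ k ∈ S, a k : ℕ) : ℝ) - Cp) / Cp := by
          show φ S / (x * Cp) ≤ (((∑ k ∈ S, a k : ℕ) : ℝ) - Cp) / Cp
          rw [div_le_div_iff₀ hxCp hCp0, hφS]
          have : max 0 (min (x * ((∑ k ∈ S, a k : ℕ) - Cp)) ((1 - x) * Cp)) ≤ x * (((∑ k ∈ S, a k : ℕ) : ℝ) - Cp) :=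
            max_le (by nlinarith) (min_le_left _ _)
          nlinarith
        have h2 : θ * κr S < (((∑ k ∈ S, a k : ℕ) : ℝ) - Cp) / Cp := lt_of_lt_of_le hθκlt h1
        have h3 : Cp * ((((∑ k ∈ S, a k : ℕ) : ℝ) - Cp) / Cp) = ((∑ k ∈ S, a k : ℕ) : ℝ) - Cp := by field_simp
        have h4 : Cp * (θ * κr S) < Cp * ((((∑ k ∈ S, a k : ℕ) : ℝ) - Cp) / Cp) := mul_lt_mul_of_pos_left h2 hCp0
        rw [h3] at h4
        linarith
      by_cases hgiant : j + 1 ≤ ∑ k ∈ S, a k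
      · have e : j + 1 - ∑ k ∈ S, a k = 0 := by omega
        rw [e, hTL0]
        have h2 : x - TL (j + 1) ≤ x := by linarith [hTLnn (j + 1)]
        have h3 : θ * κr S * (x - TL (j + 1)) ≤ (1 - x) / x * x :=
          mul_le_mul hθκ1 h2 (by linarith) (div_nonneg h1x.le hx0.le)
        have h4 : (1 - x) / x * x = 1 - x := by field_simp
        linarith
      · have hle : ∑ k ∈ S, a k ≤ j := by omega
        have hcr : (2 * j : ℝ) < CH + 2 * ((0 : ℕ) : ℝ) +
            ((∑ k ∈ S, a k - 0 : ℕ) : ℝ) * (if x ≤ γ then γ else (γ - x ^ 2) / (1 - x)) := by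
          rw [if_pos hγx, Nat.sub_zero, Nat.cast_zero, mul_zero, add_zero]
          rw [hCp] at hcredit; linarith
        have key := cloud_component_row p a x hx0 hx1 hp0 hp1 L ℓ₀ hℓ₀ hheavy j 0 (∑ k ∈ S, a k) γ hγpos.le hγ1
          (Nat.zero_le _) hle hcr
        rw [Nat.sub_zero] at key
        rw [← hinv]
        have h1 : γ * (TL (j + 1 - ∑ k ∈ S, a k) - x) ≥ (1 - γ) * (x - TL (j + 1)) := by linarith
        rw [ge_iff_le, ← div_le_iff₀' hγpos] at h1
        calc (1 - γ) / γ * (x - TL (j + 1)) = (1 - γ) * (x - TL (j + 1)) / γ := by ring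
          _ ≤ TL (j + 1 - ∑ k ∈ S, a k) - x := h1
    · -- CARRIER branch: the light route of size `h = min(a(S ∩ B), j)`
      obtain ⟨k₀, hk₀⟩ := Finset.nonempty_iff_ne_empty.2 hSB
      have hk₀S : k₀ ∈ S := (Finset.mem_inter.1 hk₀).1
      have hk₀B : k₀ ∈ B := (Finset.mem_inter.1 hk₀).2
      have hhj : min (∑ k ∈ S ∩ B, a k) j ≤ j := min_le_right _ _
      have hhk₀ : a k₀ ≤ min (∑ k ∈ S ∩ B, a k) j :=
        le_min (Finset.single_le_sum (fun i _ => Nat.zero_le _) hk₀) (hBj k₀ hk₀B)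
      have hhS : min (∑ k ∈ S ∩ B, a k) j ≤ ∑ k ∈ S, a k :=
        (min_le_left _ _).trans (Finset.sum_le_sum_of_subset (Finset.inter_subset_left))
      have hhbig : Cp < x * ((min (∑ k ∈ S ∩ B, a k) j : ℕ) : ℝ) :=
        (hBbig k₀ hk₀B).trans_le (mul_le_mul_of_nonneg_left (Nat.cast_le.2 hhk₀) hx0.le)
      have hbspos : 0 < ((min (∑ k ∈ S ∩ B, a k) j : ℕ) : ℝ) := by
        rcases (Nat.cast_nonneg (α := ℝ) (min (∑ k ∈ S ∩ B, a k) j)).lt_or_eq with h | h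
        · exact h
        · rw [← h, mul_zero] at hhbig; exact absurd hhbig (not_lt.2 hCp0.le)
      have hDpos : 0 < x ^ 2 * ((min (∑ k ∈ S ∩ B, a k) j : ℕ) : ℝ) + (1 - x) * Cp := by
        have h1 : 0 < x ^ 2 * ((min (∑ k ∈ S ∩ B, a k) j : ℕ) : ℝ) := mul_pos (pow_pos hx0 2) hbspos
        have h2 : 0 < (1 - x) * Cp := mul_pos h1x hCp0
        linarith
      have hφS : φ S = x * Cp * (((min (∑ k ∈ S ∩ B, a k) j : ℕ) : ℝ) /
          (x ^ 2 * ((min (∑ k ∈ S ∩ B, a k) j : ℕ) : ℝ) + (1 - x) * Cp) - 1) := by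
        simp only [hφ, if_neg hSB]
      have hκS : κr S = ((min (∑ k ∈ S ∩ B, a k) j : ℕ) : ℝ) /
          (x ^ 2 * ((min (∑ k ∈ S ∩ B, a k) j : ℕ) : ℝ) + (1 - x) * Cp) - 1 := by
        show φ S / (x * Cp) = _
        rw [hφS, mul_div_cancel_left₀ _ hxCp.ne']
      -- `γ > γ* = x² + (1 − x)Cp/h`, i.e. the one-light credit `h·κ_x(γ) > Cp`
      have hγgt : x ^ 2 * ((min (∑ k ∈ S ∩ B, a k) j : ℕ) : ℝ) + (1 - x) * Cp <
          γ * ((min (∑ k ∈ S ∩ B, a k) j : ℕ) : ℝ) := by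
        rw [hγ, one_div, ← div_eq_inv_mul, lt_div_iff₀ hden]
        have e : (x ^ 2 * ((min (∑ k ∈ S ∩ B, a k) j : ℕ) : ℝ) + (1 - x) * Cp) * (1 + κr S) =
            ((min (∑ k ∈ S ∩ B, a k) j : ℕ) : ℝ) := by
          rw [hκS, add_sub_cancel, mul_comm, div_mul_cancel₀ _ hDpos.ne']
        have h1 : (x ^ 2 * ((min (∑ k ∈ S ∩ B, a k) j : ℕ) : ℝ) + (1 - x) * Cp) * (1 + θ * κr S) <
            (x ^ 2 * ((min (∑ k ∈ S ∩ B, a k) j : ℕ) : ℝ) + (1 - x) * Cp) * (1 + κr S) :=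
          mul_lt_mul_of_pos_left (by linarith only [hθκlt]) hDpos
        exact h1.trans_eq e
      have hcr : (2 * j : ℝ) < CH + 2 * ((0 : ℕ) : ℝ) +
          ((min (∑ k ∈ S ∩ B, a k) j - 0 : ℕ) : ℝ) * (if x ≤ γ then γ else (γ - x ^ 2) / (1 - x)) := by
        rw [Nat.sub_zero, Nat.cast_zero, mul_zero, add_zero]
        split_ifs with hxγ
        · -- heavy route: `h·γ ≥ h·x > Cp`
          have h1 : x * ((min (∑ k ∈ S ∩ B, a k) j : ℕ) : ℝ) ≤ γ * ((min (∑ k ∈ S ∩ B, a k) j : ℕ) : ℝ) :=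
            mul_le_mul_of_nonneg_right hxγ hbspos.le
          have h2 : γ * ((min (∑ k ∈ S ∩ B, a k) j : ℕ) : ℝ) = ((min (∑ k ∈ S ∩ B, a k) j : ℕ) : ℝ) * γ := mul_comm _ _
          rw [hCp] at hhbig; linarith only [hhbig, h1, h2]
        · -- light route: `h(γ − x²)/(1 − x) > Cp`
          have h1 : Cp * (1 - x) < ((min (∑ k ∈ S ∩ B, a k) j : ℕ) : ℝ) * (γ - x ^ 2) := by
            have e : ((min (∑ k ∈ S ∩ B, a k) j : ℕ) : ℝ) * (γ - x ^ 2) =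
                γ * ((min (∑ k ∈ S ∩ B, a k) j : ℕ) : ℝ) - x ^ 2 * ((min (∑ k ∈ S ∩ B, a k) j : ℕ) : ℝ) := by ring
            rw [e]; linarith only [hγgt]
          have h2 : Cp < ((min (∑ k ∈ S ∩ B, a k) j : ℕ) : ℝ) * (γ - x ^ 2) / (1 - x) := (lt_div_iff₀ h1x).2 h1
          rw [mul_div_assoc']
          rw [hCp] at h2; linarith only [h2]
      have key := cloud_component_row p a x hx0 hx1 hp0 hp1 L ℓ₀ hℓ₀ hheavy j 0 (min (∑ k ∈ S ∩ B, a k) j) γ hγpos.le hγ1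
        (Nat.zero_le _) hhj hcr
      rw [Nat.sub_zero] at key
      -- the outcome is at least as deep as `h`
      have hmono : TL (j + 1 - min (∑ k ∈ S ∩ B, a k) j) ≤ TL (j + 1 - ∑ k ∈ S, a k) := hTLanti (by omega)
      rw [← hinv]
      have h1 : γ * (TL (j + 1 - min (∑ k ∈ S ∩ B, a k) j) - x) ≥ (1 - γ) * (x - TL (j + 1)) := by linarith only [key]
      rw [ge_iff_le, ← div_le_iff₀' hγpos] at h1
      calc (1 - γ) / γ * (x - TL (j + 1)) = (1 - γ) * (x - TL (j + 1)) / γ := by ring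
        _ ≤ TL (j + 1 - min (∑ k ∈ S ∩ B, a k) j) - x := h1
        _ ≤ TL (j + 1 - ∑ k ∈ S, a k) - x := by linarith only [hmono]
  -- summing the payments (verbatim `tail_ge_of_clampCert`)
  have hsum := Finset.sum_le_sum hpay
  rw [Finset.sum_sub_distrib, Finset.sum_ite_eq' L.powerset (∅ : Finset κ), if_pos (Finset.empty_mem_powerset L)] at hsum
  have e1 : ∑ S ∈ L.powerset, wL S * (θ * κr S * (x - TL (j + 1))) = θ * (x - TL (j + 1)) * (RHS / (x * Cp)) := by
    rw [hRHS, Finset.sum_div, Finset.mul_sum]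
    refine Finset.sum_congr rfl fun S _ => ?_
    show wL S * (θ * (φ S / (x * Cp)) * (x - TL (j + 1))) = θ * (x - TL (j + 1)) * (wL S * φ S / (x * Cp))
    ring
  have e2 : ∑ S ∈ L.powerset, wL S * (TL (j + 1 - ∑ k ∈ S, a k) - x) =
      (∑ S ∈ L.powerset, wL S * TL (j + 1 - ∑ k ∈ S, a k)) - x := by
    rw [Finset.sum_congr rfl fun S _ => mul_sub (wL S) _ _, Finset.sum_sub_distrib, ← Finset.sum_mul,
      sum_powerset_weight p L, one_mul]
  rw [e1, e2] at hsum
  have e3 : θ * (x - TL (j + 1)) * (RHS / (x * Cp)) = (x - TL (j + 1)) * (wL ∅ + (RHS - LHS) / 2 / (x * Cp)) := by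
    have : θ * (RHS / (x * Cp)) = (θ * RHS) / (x * Cp) := by ring
    rw [mul_comm θ, mul_assoc, this, hθRHS, hLHS]
    field_simp
  rw [e3] at hsum
  have hslack : 0 ≤ (x - TL (j + 1)) * ((RHS - LHS) / 2 / (x * Cp)) :=
    mul_nonneg (by linarith) (div_nonneg (by linarith) hxCp.le)
  have e4 : (x - TL (j + 1)) * (wL ∅ + (RHS - LHS) / 2 / (x * Cp)) - wL ∅ * (x - TL (j + 1)) =
      (x - TL (j + 1)) * ((RHS - LHS) / 2 / (x * Cp)) := by ring
  linarith

end IndepBlob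

end Quant

end Summit.CriticalPhenomena.PercolationContinuityZ3.Theorems
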